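/-
Copyright (c) 2026 the pub-hodgecm-mathlib formalisation cell (harness21).  Prover seat hodgecm-mathlib-F0P3a-p05 (g17): road «S3-ram» (LEAD F0P3a-plan (g12); owner∕table
F0P3a-p06 (g15); architect A-p16 (g31); junction sub-architect F0P3a-p01 (g17)); item «COUNT TRANSPORT TO EVERY MODEL `c • ᵗσ(P) H P`» (the COUNT twin of J2 ★ p847369,
the `c •` half of ★ p847249 §5); 2026-09-02.
-/
import Literature.NumberTheory.Automorphic.UnitaryLatticeTreeFormTransport   -- ★ p847249 (F0P3a-p01 (g16)): §5 `ncard_selfDual_fixed_{sep,bd,deep,reg,rankOne}_eq_of_formCongr`; brings ★ `isVertexLattice_smul_iff` (F0P2-p06 (g10)), ★ `UnitaryLatticeTreeFrameChange`, ★ `UnitaryLatticeTreeDefs`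
import HarnessLib

/-!
# The lattice graph of a hermitian space — the five strata counts of a fixed element are THE SAME for a form `H` and its unit rescaling `c • H` (`|c| = 1`), up to the
# shift `c₀ ↦ c·c₀` of the rank-one class constant; hence they transport to EVERY MODEL `c • ᵗσ(P) H P` of `H` (Bruhat–Tits 1972 §10; Kottwitz 1986 §3; Rogawski 1990 §4.9)

Topic `NumberTheory/Automorphic`; namespace `Literature.NumberTheory.Automorphic.UnitaryLatticeTree`.  THEOREMS ONLY (no definition, no instance, no notation, no named fact,
no `sorry`); kernel lane `--supports stmt-HodgeConjecture-24833`; datum-free (`K` any field with `Valued K ℤᵐ⁰`, `σ` any ring endomorphism, any rank `N`, any `γ ∈ GL_N(K)`).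
Cell `pub/hodgecm-mathlib` (D-0151), crux H413; road «S3-ram» (Literature seeding, count-neutral), P-1-ram organ A′e, the JUNCTION (J★) of F0P3a-p01 (g16∕g17): the tree-induction
engine runs in the antidiagonal `J₀`-model (root `𝒪³`, element `A·T·A⁻¹`), while the head (J★) `stub_signedStrataCount_typeOne_ram` counts `T`-fixed self-dual lattices for the
DIAGONAL forms `D_b = diag(ε^{b₁}u₀, ε^{b₂}u₁, ε^{b₁+b₂}u₂)`; every unimodular form is a model `D = c • ᵗσ(A) J₀ A` with `|c| = 1`, `A ∈ GL₃(K)` (★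
`exists_glInt_diagonal_eq_smul_formCongr_antidiagonal` and kin), and architect A-p16 (g31) 2026-09-02T00:44:53Z: «reach the D-model head (J★) at the END by ★ p847249 §5 + unit
rescaling».  ★ p847249 §5 (F0P3a-p01 (g16)) is the `ᵗσ(P) H P` half (change of basis `M ↦ P·M`, `γ ↦ PγP⁻¹`); ★ p847369 (F0P3-p03 (g15), J2) transported ALTERNATION to every model
`c • ᵗσ(P) H P`.  THIS FILE is the `c •` half for the COUNTS and the composite.

THE MATHEMATICS (elementary).  For `|c| = 1`: (§1) a lattice is self-dual for `c • H` iff for `H` (★ `isVertexLattice_smul_iff` at type `0`: the Gram matrix scales by the unit `c`);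
the pairing scales, `B_{c•H}(y, z) = c·B_H(y, z)`; so the rank-one CLASS TOKEN «`|ϖ′·B(y, Ay) − c₀·a²| < 1` for some `y ∈ M`, `|a| = 1`» for `c • H` with constant `c·c₀` is the
token for `H` with constant `c₀` (`|c·x| = |x|`), equivalently constant `c₀` for `c • H` is constant `c⁻¹·c₀` for `H`; the fixedness `γM = M` and the LEVEL tokens `(γ − 1)M ⊆ ϖ^k M`,
`(γ − 1)²M ⊆ ϖ^k M` do not mention the form.  (§2) Hence for every label `Q` not involving the form the stratum SETS `{M self-dual, γM = M, Q M}` of `c • H` and `H` COINCIDE, and so do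
the five strata counts «bd ∕ 0 ∕ reg ∕ 1□_{c₀}» of the (a2) token sheet (the last with the constant shift).  (§3) Composing with ★ p847249 §5: the five counts for
(`H`, `PγP⁻¹`, constant `c₀`) equal those for the model (`c • ᵗσ(P) H P`, `γ`, constant `c·c₀`) — resp. (`H`, `PγP⁻¹`, `c⁻¹·c₀`) ↔ (model, `γ`, `c₀`) — with the token shapes of ★
p847249 §5 VERBATIM, the model form substituted.
HONEST LABEL: HC_CM is proved only modulo the 2 remaining named inputs (hLiu418 24832, h413 24833) until rung 0 closes; nothing printed is asserted here (bookkeeping).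

* §1 `isSelfDualLattice_smul_form_iff`, `pairing_smul_form`, `exists_mem_class_smul_form_iff` (constant `c·c₀ ↔ c₀`), `exists_mem_class_smul_form_iff_inv` (`c₀ ↔ c⁻¹·c₀`).
* §2 `setOf_selfDual_fixed_sep_smul_form_eq` (sets coincide, general label), `ncard_selfDual_fixed_{bd,deep,reg}_smul_form_eq`, `ncard_selfDual_fixed_rankOne_smul_form_eq` (+ `_inv`).
* §3 `ncard_selfDual_fixed_sep_eq_of_smul_formCongr` (general label), `ncard_selfDual_fixed_{bd,deep,reg}_eq_of_smul_formCongr`, `ncard_selfDual_fixed_rankOne_eq_of_smul_formCongr`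
  (`c₀ ↔ c·c₀`), `ncard_selfDual_fixed_rankOne_eq_of_smul_formCongr_inv` (`c⁻¹·c₀ ↔ c₀`).

## References
* [BruhatTits1972] F. Bruhat, J. Tits, *Groupes réductifs sur un corps local I*, Publ. Math. IHÉS 41 (1972), §10 (the lattice model of the building; homothety of the form).
* [Kottwitz1986] R. E. Kottwitz, *Base change for unit elements of Hecke algebras*, Compositio Math. 60 (1986), §3 (counting `γ`-fixed lattices in a convenient model).
* [Rogawski1990] J. D. Rogawski, *Automorphic Representations of Unitary Groups in Three Variables*, Ann. of Math. Stud. 123 (1990), §4.9 pp. 54–55, Lemma 4.9.3.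
* [Jacobowitz1962] R. Jacobowitz, *Hermitian forms over local fields*, Amer. J. Math. 84 (1962), §4 (scaling of a hermitian form).
-/

set_option autoImplicit false

noncomputable section

open scoped Valued WithZero Matrix MatrixGroups

namespace Literature.NumberTheory.Automorphic.UnitaryLatticeTree

open Literature.NumberTheory.Automorphic Literature.NumberTheory.Automorphic.HermitianLattice

variable {K : Type*} [Field K] [Valued K ℤᵐ⁰] {N : ℕ}

/-! ## §1 Unit rescaling of the form: self-duality, the pairing, the class token -/

/-- `M` is self-dual for `c • H` iff for `H` (`|c| = 1`). [cite: BruhatTits1972, §10] [cite: Jacobowitz1962, §4] -/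
theorem isSelfDualLattice_smul_form_iff (σ : K →+* K) (ϖ : K) {c : K} (hc : Valued.v c = 1) (H : Matrix (Fin N) (Fin N) K) (M : Submodule 𝒪[K] (Fin N → K)) :
    IsSelfDualLattice σ ϖ (c • H) M ↔ IsSelfDualLattice σ ϖ H M :=
  isVertexLattice_smul_iff (σ := σ) (ϖ := ϖ) hc H 0 M

omit [Valued K ℤᵐ⁰] in
/-- The pairing of the rescaled form: `B_{c•H}(x, y) = c·B_H(x, y)`. [cite: Jacobowitz1962, §4] -/
theorem pairing_smul_form (σ : K →+* K) (c : K) (H : Matrix (Fin N) (Fin N) K) (x y : Fin N → K) :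
    pairing σ (c • H) x y = c * pairing σ H x y := by
  simp only [pairing_apply, Matrix.smul_apply, smul_eq_mul, Finset.mul_sum]
  exact Finset.sum_congr rfl fun i _ => Finset.sum_congr rfl fun j _ => by ring

/-- **THE CLASS TOKEN UNDER A UNIT RESCALING** (`|c| = 1`): «some `y ∈ M` has `|ϖ′·B_{c•H}(y, A y) − (c·c₀)·a²| < 1` with `|a| = 1`» iff «some `y ∈ M` has
`|ϖ′·B_H(y, A y) − c₀·a²| < 1` with `|a| = 1`» (the value scales by the unit `c`). [cite: Jacobowitz1962, §4] [cite: Rogawski1990, §4.9 p. 55] -/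
theorem exists_mem_class_smul_form_iff (σ : K →+* K) {c : K} (hc : Valued.v c = 1) (H : Matrix (Fin N) (Fin N) K) (A : Matrix (Fin N) (Fin N) K) (ϖ' c₀ : K)
    (M : Submodule 𝒪[K] (Fin N → K)) :
    (∃ y ∈ M, ∃ a : K, Valued.v a = 1 ∧ Valued.v (ϖ' * pairing σ (c • H) y (A *ᵥ y) - c * c₀ * a ^ 2) < 1) ↔
      ∃ y ∈ M, ∃ a : K, Valued.v a = 1 ∧ Valued.v (ϖ' * pairing σ H y (A *ᵥ y) - c₀ * a ^ 2) < 1 := by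
  refine exists_congr fun y => and_congr Iff.rfl (exists_congr fun a => and_congr Iff.rfl ?_)
  rw [pairing_smul_form, show ϖ' * (c * pairing σ H y (A *ᵥ y)) - c * c₀ * a ^ 2 = c * (ϖ' * pairing σ H y (A *ᵥ y) - c₀ * a ^ 2) by ring,
    map_mul, hc, one_mul]

/-- The same with the constant on the rescaled side unchanged: constant `c₀` for `c • H` is constant `c⁻¹·c₀` for `H` (`|c| = 1`). [cite: Jacobowitz1962, §4] [cite: Rogawski1990, §4.9 p. 55] -/
theorem exists_mem_class_smul_form_iff_inv (σ : K →+* K) {c : K} (hc : Valued.v c = 1) (H : Matrix (Fin N) (Fin N) K) (A : Matrix (Fin N) (Fin N) K) (ϖ' c₀ : K)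
    (M : Submodule 𝒪[K] (Fin N → K)) :
    (∃ y ∈ M, ∃ a : K, Valued.v a = 1 ∧ Valued.v (ϖ' * pairing σ (c • H) y (A *ᵥ y) - c₀ * a ^ 2) < 1) ↔
      ∃ y ∈ M, ∃ a : K, Valued.v a = 1 ∧ Valued.v (ϖ' * pairing σ H y (A *ᵥ y) - c⁻¹ * c₀ * a ^ 2) < 1 := by
  have hc0 : c ≠ 0 := fun h => by rw [h, map_zero] at hc; exact zero_ne_one hc
  have hcc : c * (c⁻¹ * c₀) = c₀ := by rw [← mul_assoc, mul_inv_cancel₀ hc0, one_mul]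
  rw [← exists_mem_class_smul_form_iff σ hc H A ϖ' (c⁻¹ * c₀) M, hcc]

/-! ## §2 The strata of `c • H` and of `H` coincide -/

/-- **THE STRATA SETS COINCIDE** (general label): for `|c| = 1` and labels `Q₁ ↔ Q₂` pointwise, `{M self-dual for c•H, γM = M, Q₁ M} = {M self-dual for H, γM = M, Q₂ M}`.
[cite: BruhatTits1972, §10] [cite: Kottwitz1986, §3] -/
theorem setOf_selfDual_fixed_sep_smul_form_eq (σ : K →+* K) (ϖ : K) {c : K} (hc : Valued.v c = 1) (H : Matrix (Fin N) (Fin N) K) (γ : GL (Fin N) K)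
    (Q₁ Q₂ : Submodule 𝒪[K] (Fin N → K) → Prop) (hQ : ∀ M, Q₁ M ↔ Q₂ M) :
    {M : Submodule 𝒪[K] (Fin N → K) | IsSelfDualLattice σ ϖ (c • H) M ∧ mapGL γ M = M ∧ Q₁ M} =
      {M : Submodule 𝒪[K] (Fin N → K) | IsSelfDualLattice σ ϖ H M ∧ mapGL γ M = M ∧ Q₂ M} := by
  ext M
  simp only [Set.mem_setOf_eq, isSelfDualLattice_smul_form_iff σ ϖ hc H M, hQ M]

/-- **COUNTS UNDER A UNIT RESCALING, stratum «bd»** (`¬ (γ−1)M ⊆ ϖM`). [cite: Rogawski1990, §4.9 p. 55] [cite: Kottwitz1986, §3] -/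
theorem ncard_selfDual_fixed_bd_smul_form_eq (σ : K →+* K) (ϖ : K) {c : K} (hc : Valued.v c = 1) (H : Matrix (Fin N) (Fin N) K) (γ : GL (Fin N) K) :
    {M : Submodule 𝒪[K] (Fin N → K) | IsSelfDualLattice σ ϖ (c • H) M ∧ mapGL γ M = M ∧
        ¬ M.map ((Matrix.toLin' ((γ : Matrix (Fin N) (Fin N) K) - 1)).restrictScalars 𝒪[K]) ≤ scaleLattice ϖ M}.ncard =
      {M : Submodule 𝒪[K] (Fin N → K) | IsSelfDualLattice σ ϖ H M ∧ mapGL γ M = M ∧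
        ¬ M.map ((Matrix.toLin' ((γ : Matrix (Fin N) (Fin N) K) - 1)).restrictScalars 𝒪[K]) ≤ scaleLattice ϖ M}.ncard := by
  rw [setOf_selfDual_fixed_sep_smul_form_eq σ ϖ hc H γ _ _ fun M => Iff.rfl]

/-- **COUNTS UNDER A UNIT RESCALING, stratum «0»** (`(γ−1)M ⊆ ϖ²M`). [cite: Rogawski1990, §4.9 p. 55] [cite: Kottwitz1986, §3] -/
theorem ncard_selfDual_fixed_deep_smul_form_eq (σ : K →+* K) (ϖ : K) {c : K} (hc : Valued.v c = 1) (H : Matrix (Fin N) (Fin N) K) (γ : GL (Fin N) K) :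
    {M : Submodule 𝒪[K] (Fin N → K) | IsSelfDualLattice σ ϖ (c • H) M ∧ mapGL γ M = M ∧
        M.map ((Matrix.toLin' ((γ : Matrix (Fin N) (Fin N) K) - 1)).restrictScalars 𝒪[K]) ≤ scaleLattice (ϖ ^ 2) M}.ncard =
      {M : Submodule 𝒪[K] (Fin N → K) | IsSelfDualLattice σ ϖ H M ∧ mapGL γ M = M ∧
        M.map ((Matrix.toLin' ((γ : Matrix (Fin N) (Fin N) K) - 1)).restrictScalars 𝒪[K]) ≤ scaleLattice (ϖ ^ 2) M}.ncard := by
  rw [setOf_selfDual_fixed_sep_smul_form_eq σ ϖ hc H γ _ _ fun M => Iff.rfl]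

/-- **COUNTS UNDER A UNIT RESCALING, stratum «reg»** (`(γ−1)M ⊆ ϖM`, `¬ ⊆ ϖ²M`, `¬ (γ−1)²M ⊆ ϖ³M`). [cite: Rogawski1990, §4.9 p. 55] [cite: Kottwitz1986, §3] -/
theorem ncard_selfDual_fixed_reg_smul_form_eq (σ : K →+* K) (ϖ : K) {c : K} (hc : Valued.v c = 1) (H : Matrix (Fin N) (Fin N) K) (γ : GL (Fin N) K) :
    {M : Submodule 𝒪[K] (Fin N → K) | IsSelfDualLattice σ ϖ (c • H) M ∧ mapGL γ M = M ∧
        (M.map ((Matrix.toLin' ((γ : Matrix (Fin N) (Fin N) K) - 1)).restrictScalars 𝒪[K]) ≤ scaleLattice ϖ M ∧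
          ¬ M.map ((Matrix.toLin' ((γ : Matrix (Fin N) (Fin N) K) - 1)).restrictScalars 𝒪[K]) ≤ scaleLattice (ϖ ^ 2) M ∧
            ¬ M.map ((Matrix.toLin' (((γ : Matrix (Fin N) (Fin N) K) - 1) ^ 2)).restrictScalars 𝒪[K]) ≤ scaleLattice (ϖ ^ 3) M)}.ncard =
      {M : Submodule 𝒪[K] (Fin N → K) | IsSelfDualLattice σ ϖ H M ∧ mapGL γ M = M ∧
        (M.map ((Matrix.toLin' ((γ : Matrix (Fin N) (Fin N) K) - 1)).restrictScalars 𝒪[K]) ≤ scaleLattice ϖ M ∧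
          ¬ M.map ((Matrix.toLin' ((γ : Matrix (Fin N) (Fin N) K) - 1)).restrictScalars 𝒪[K]) ≤ scaleLattice (ϖ ^ 2) M ∧
            ¬ M.map ((Matrix.toLin' (((γ : Matrix (Fin N) (Fin N) K) - 1) ^ 2)).restrictScalars 𝒪[K]) ≤ scaleLattice (ϖ ^ 3) M)}.ncard := by
  rw [setOf_selfDual_fixed_sep_smul_form_eq σ ϖ hc H γ _ _ fun M => Iff.rfl]

/-- **COUNTS UNDER A UNIT RESCALING, the rank-one strata «1□»** (`(γ−1)M ⊆ ϖM`, `¬ ⊆ ϖ²M`, `(γ−1)²M ⊆ ϖ³M`, class token): constant `c·c₀` for `c • H` ↔ constant `c₀` for `H`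
(`|c| = 1`). [cite: Rogawski1990, §4.9 p. 55] [cite: Kottwitz1986, §3] -/
theorem ncard_selfDual_fixed_rankOne_smul_form_eq (σ : K →+* K) (ϖ : K) {c : K} (hc : Valued.v c = 1) (H : Matrix (Fin N) (Fin N) K) (γ : GL (Fin N) K) (ϖ' c₀ : K) :
    {M : Submodule 𝒪[K] (Fin N → K) | IsSelfDualLattice σ ϖ (c • H) M ∧ mapGL γ M = M ∧
        (M.map ((Matrix.toLin' ((γ : Matrix (Fin N) (Fin N) K) - 1)).restrictScalars 𝒪[K]) ≤ scaleLattice ϖ M ∧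
          ¬ M.map ((Matrix.toLin' ((γ : Matrix (Fin N) (Fin N) K) - 1)).restrictScalars 𝒪[K]) ≤ scaleLattice (ϖ ^ 2) M ∧
            M.map ((Matrix.toLin' (((γ : Matrix (Fin N) (Fin N) K) - 1) ^ 2)).restrictScalars 𝒪[K]) ≤ scaleLattice (ϖ ^ 3) M ∧
              ∃ y ∈ M, ∃ a : K, Valued.v a = 1 ∧
                Valued.v (ϖ' * pairing σ (c • H) y (((γ : Matrix (Fin N) (Fin N) K) - 1) *ᵥ y) - c * c₀ * a ^ 2) < 1)}.ncard =
      {M : Submodule 𝒪[K] (Fin N → K) | IsSelfDualLattice σ ϖ H M ∧ mapGL γ M = M ∧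
        (M.map ((Matrix.toLin' ((γ : Matrix (Fin N) (Fin N) K) - 1)).restrictScalars 𝒪[K]) ≤ scaleLattice ϖ M ∧
          ¬ M.map ((Matrix.toLin' ((γ : Matrix (Fin N) (Fin N) K) - 1)).restrictScalars 𝒪[K]) ≤ scaleLattice (ϖ ^ 2) M ∧
            M.map ((Matrix.toLin' (((γ : Matrix (Fin N) (Fin N) K) - 1) ^ 2)).restrictScalars 𝒪[K]) ≤ scaleLattice (ϖ ^ 3) M ∧
              ∃ y ∈ M, ∃ a : K, Valued.v a = 1 ∧
                Valued.v (ϖ' * pairing σ H y (((γ : Matrix (Fin N) (Fin N) K) - 1) *ᵥ y) - c₀ * a ^ 2) < 1)}.ncard := by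
  rw [setOf_selfDual_fixed_sep_smul_form_eq σ ϖ hc H γ _ _ fun M => by rw [exists_mem_class_smul_form_iff σ hc H _ ϖ' c₀ M]]

/-- The rank-one strata, constant `c₀` for `c • H` ↔ constant `c⁻¹·c₀` for `H` (`|c| = 1`). [cite: Rogawski1990, §4.9 p. 55] [cite: Kottwitz1986, §3] -/
theorem ncard_selfDual_fixed_rankOne_smul_form_eq_inv (σ : K →+* K) (ϖ : K) {c : K} (hc : Valued.v c = 1) (H : Matrix (Fin N) (Fin N) K) (γ : GL (Fin N) K) (ϖ' c₀ : K) :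
    {M : Submodule 𝒪[K] (Fin N → K) | IsSelfDualLattice σ ϖ (c • H) M ∧ mapGL γ M = M ∧
        (M.map ((Matrix.toLin' ((γ : Matrix (Fin N) (Fin N) K) - 1)).restrictScalars 𝒪[K]) ≤ scaleLattice ϖ M ∧
          ¬ M.map ((Matrix.toLin' ((γ : Matrix (Fin N) (Fin N) K) - 1)).restrictScalars 𝒪[K]) ≤ scaleLattice (ϖ ^ 2) M ∧
            M.map ((Matrix.toLin' (((γ : Matrix (Fin N) (Fin N) K) - 1) ^ 2)).restrictScalars 𝒪[K]) ≤ scaleLattice (ϖ ^ 3) M ∧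
              ∃ y ∈ M, ∃ a : K, Valued.v a = 1 ∧
                Valued.v (ϖ' * pairing σ (c • H) y (((γ : Matrix (Fin N) (Fin N) K) - 1) *ᵥ y) - c₀ * a ^ 2) < 1)}.ncard =
      {M : Submodule 𝒪[K] (Fin N → K) | IsSelfDualLattice σ ϖ H M ∧ mapGL γ M = M ∧
        (M.map ((Matrix.toLin' ((γ : Matrix (Fin N) (Fin N) K) - 1)).restrictScalars 𝒪[K]) ≤ scaleLattice ϖ M ∧
          ¬ M.map ((Matrix.toLin' ((γ : Matrix (Fin N) (Fin N) K) - 1)).restrictScalars 𝒪[K]) ≤ scaleLattice (ϖ ^ 2) M ∧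
            M.map ((Matrix.toLin' (((γ : Matrix (Fin N) (Fin N) K) - 1) ^ 2)).restrictScalars 𝒪[K]) ≤ scaleLattice (ϖ ^ 3) M ∧
              ∃ y ∈ M, ∃ a : K, Valued.v a = 1 ∧
                Valued.v (ϖ' * pairing σ H y (((γ : Matrix (Fin N) (Fin N) K) - 1) *ᵥ y) - c⁻¹ * c₀ * a ^ 2) < 1)}.ncard := by
  rw [setOf_selfDual_fixed_sep_smul_form_eq σ ϖ hc H γ _ _ fun M => by rw [exists_mem_class_smul_form_iff_inv σ hc H _ ϖ' c₀ M]]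

/-! ## §3 Composite with ★ p847249 §5: the counts transport to every model `c • ᵗσ(P) H P` -/

/-- **COUNT TRANSPORT TO A MODEL (general label)**: if `Q₁ (P·M) ↔ Q₂ M` for all `M`, then for `|c| = 1`
`#{M self-dual for H, (PγP⁻¹)M = M, Q₁ M} = #{M self-dual for c • ᵗσ(P)HP, γM = M, Q₂ M}`. [cite: Kottwitz1986, §3] [cite: Rogawski1990, §4.9 Lemma 4.9.3] -/
theorem ncard_selfDual_fixed_sep_eq_of_smul_formCongr (σ : K →+* K) (ϖ : K) {c : K} (hc : Valued.v c = 1) (H : Matrix (Fin N) (Fin N) K) (P γ : GL (Fin N) K)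
    (Q₁ Q₂ : Submodule 𝒪[K] (Fin N → K) → Prop) (hQ : ∀ M, Q₁ (mapGL P M) ↔ Q₂ M) :
    {M : Submodule 𝒪[K] (Fin N → K) | IsSelfDualLattice σ ϖ H M ∧ mapGL (P * γ * P⁻¹) M = M ∧ Q₁ M}.ncard =
      {M : Submodule 𝒪[K] (Fin N → K) | IsSelfDualLattice σ ϖ (c • formCongr σ P H) M ∧ mapGL γ M = M ∧ Q₂ M}.ncard := by
  rw [ncard_selfDual_fixed_sep_eq_of_formCongr σ ϖ H P γ Q₁ Q₂ hQ, setOf_selfDual_fixed_sep_smul_form_eq σ ϖ hc (formCongr σ P H) γ Q₂ Q₂ fun M => Iff.rfl]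

/-- **COUNT TRANSPORT TO A MODEL, stratum «bd».** [cite: Rogawski1990, §4.9 p. 55] [cite: Kottwitz1986, §3] -/
theorem ncard_selfDual_fixed_bd_eq_of_smul_formCongr (σ : K →+* K) (ϖ : K) {c : K} (hc : Valued.v c = 1) (H : Matrix (Fin N) (Fin N) K) (P γ : GL (Fin N) K) :
    {M : Submodule 𝒪[K] (Fin N → K) | IsSelfDualLattice σ ϖ H M ∧ mapGL (P * γ * P⁻¹) M = M ∧
        ¬ M.map ((Matrix.toLin' (((P * γ * P⁻¹ : GL (Fin N) K) : Matrix (Fin N) (Fin N) K) - 1)).restrictScalars 𝒪[K]) ≤ scaleLattice ϖ M}.ncard =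
      {M : Submodule 𝒪[K] (Fin N → K) | IsSelfDualLattice σ ϖ (c • formCongr σ P H) M ∧ mapGL γ M = M ∧
        ¬ M.map ((Matrix.toLin' ((γ : Matrix (Fin N) (Fin N) K) - 1)).restrictScalars 𝒪[K]) ≤ scaleLattice ϖ M}.ncard := by
  rw [ncard_selfDual_fixed_bd_eq_of_formCongr σ ϖ H P γ, ncard_selfDual_fixed_bd_smul_form_eq σ ϖ hc]

/-- **COUNT TRANSPORT TO A MODEL, stratum «0».** [cite: Rogawski1990, §4.9 p. 55] [cite: Kottwitz1986, §3] -/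
theorem ncard_selfDual_fixed_deep_eq_of_smul_formCongr (σ : K →+* K) (ϖ : K) {c : K} (hc : Valued.v c = 1) (H : Matrix (Fin N) (Fin N) K) (P γ : GL (Fin N) K) :
    {M : Submodule 𝒪[K] (Fin N → K) | IsSelfDualLattice σ ϖ H M ∧ mapGL (P * γ * P⁻¹) M = M ∧
        M.map ((Matrix.toLin' (((P * γ * P⁻¹ : GL (Fin N) K) : Matrix (Fin N) (Fin N) K) - 1)).restrictScalars 𝒪[K]) ≤ scaleLattice (ϖ ^ 2) M}.ncard =
      {M : Submodule 𝒪[K] (Fin N → K) | IsSelfDualLattice σ ϖ (c • formCongr σ P H) M ∧ mapGL γ M = M ∧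
        M.map ((Matrix.toLin' ((γ : Matrix (Fin N) (Fin N) K) - 1)).restrictScalars 𝒪[K]) ≤ scaleLattice (ϖ ^ 2) M}.ncard := by
  rw [ncard_selfDual_fixed_deep_eq_of_formCongr σ ϖ H P γ, ncard_selfDual_fixed_deep_smul_form_eq σ ϖ hc]

/-- **COUNT TRANSPORT TO A MODEL, stratum «reg».** [cite: Rogawski1990, §4.9 p. 55] [cite: Kottwitz1986, §3] -/
theorem ncard_selfDual_fixed_reg_eq_of_smul_formCongr (σ : K →+* K) (ϖ : K) {c : K} (hc : Valued.v c = 1) (H : Matrix (Fin N) (Fin N) K) (P γ : GL (Fin N) K) :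
    {M : Submodule 𝒪[K] (Fin N → K) | IsSelfDualLattice σ ϖ H M ∧ mapGL (P * γ * P⁻¹) M = M ∧
        (M.map ((Matrix.toLin' (((P * γ * P⁻¹ : GL (Fin N) K) : Matrix (Fin N) (Fin N) K) - 1)).restrictScalars 𝒪[K]) ≤ scaleLattice ϖ M ∧
          ¬ M.map ((Matrix.toLin' (((P * γ * P⁻¹ : GL (Fin N) K) : Matrix (Fin N) (Fin N) K) - 1)).restrictScalars 𝒪[K]) ≤ scaleLattice (ϖ ^ 2) M ∧
            ¬ M.map ((Matrix.toLin' ((((P * γ * P⁻¹ : GL (Fin N) K) : Matrix (Fin N) (Fin N) K) - 1) ^ 2)).restrictScalars 𝒪[K]) ≤ scaleLattice (ϖ ^ 3) M)}.ncard =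
      {M : Submodule 𝒪[K] (Fin N → K) | IsSelfDualLattice σ ϖ (c • formCongr σ P H) M ∧ mapGL γ M = M ∧
        (M.map ((Matrix.toLin' ((γ : Matrix (Fin N) (Fin N) K) - 1)).restrictScalars 𝒪[K]) ≤ scaleLattice ϖ M ∧
          ¬ M.map ((Matrix.toLin' ((γ : Matrix (Fin N) (Fin N) K) - 1)).restrictScalars 𝒪[K]) ≤ scaleLattice (ϖ ^ 2) M ∧
            ¬ M.map ((Matrix.toLin' (((γ : Matrix (Fin N) (Fin N) K) - 1) ^ 2)).restrictScalars 𝒪[K]) ≤ scaleLattice (ϖ ^ 3) M)}.ncard := by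
  rw [ncard_selfDual_fixed_reg_eq_of_formCongr σ ϖ H P γ, ncard_selfDual_fixed_reg_smul_form_eq σ ϖ hc]

/-- **COUNT TRANSPORT TO A MODEL, the rank-one strata «1□»**: constant `c₀` for (`H`, `PγP⁻¹`) ↔ constant `c·c₀` for the model (`c • ᵗσ(P)HP`, `γ`) (`|c| = 1`; the form
moves with the basis, ★ p847249, and then scales by `c`). [cite: Rogawski1990, §4.9 p. 55] [cite: Kottwitz1986, §3] -/
theorem ncard_selfDual_fixed_rankOne_eq_of_smul_formCongr (σ : K →+* K) (ϖ : K) {c : K} (hc : Valued.v c = 1) (H : Matrix (Fin N) (Fin N) K) (P γ : GL (Fin N) K) (ϖ' c₀ : K) :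
    {M : Submodule 𝒪[K] (Fin N → K) | IsSelfDualLattice σ ϖ H M ∧ mapGL (P * γ * P⁻¹) M = M ∧
        (M.map ((Matrix.toLin' (((P * γ * P⁻¹ : GL (Fin N) K) : Matrix (Fin N) (Fin N) K) - 1)).restrictScalars 𝒪[K]) ≤ scaleLattice ϖ M ∧
          ¬ M.map ((Matrix.toLin' (((P * γ * P⁻¹ : GL (Fin N) K) : Matrix (Fin N) (Fin N) K) - 1)).restrictScalars 𝒪[K]) ≤ scaleLattice (ϖ ^ 2) M ∧
            M.map ((Matrix.toLin' ((((P * γ * P⁻¹ : GL (Fin N) K) : Matrix (Fin N) (Fin N) K) - 1) ^ 2)).restrictScalars 𝒪[K]) ≤ scaleLattice (ϖ ^ 3) M ∧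
              ∃ y ∈ M, ∃ a : K, Valued.v a = 1 ∧
                Valued.v (ϖ' * pairing σ H y ((((P * γ * P⁻¹ : GL (Fin N) K) : Matrix (Fin N) (Fin N) K) - 1) *ᵥ y) - c₀ * a ^ 2) < 1)}.ncard =
      {M : Submodule 𝒪[K] (Fin N → K) | IsSelfDualLattice σ ϖ (c • formCongr σ P H) M ∧ mapGL γ M = M ∧
        (M.map ((Matrix.toLin' ((γ : Matrix (Fin N) (Fin N) K) - 1)).restrictScalars 𝒪[K]) ≤ scaleLattice ϖ M ∧
          ¬ M.map ((Matrix.toLin' ((γ : Matrix (Fin N) (Fin N) K) - 1)).restrictScalars 𝒪[K]) ≤ scaleLattice (ϖ ^ 2) M ∧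
            M.map ((Matrix.toLin' (((γ : Matrix (Fin N) (Fin N) K) - 1) ^ 2)).restrictScalars 𝒪[K]) ≤ scaleLattice (ϖ ^ 3) M ∧
              ∃ y ∈ M, ∃ a : K, Valued.v a = 1 ∧
                Valued.v (ϖ' * pairing σ (c • formCongr σ P H) y (((γ : Matrix (Fin N) (Fin N) K) - 1) *ᵥ y) - c * c₀ * a ^ 2) < 1)}.ncard := by
  rw [ncard_selfDual_fixed_rankOne_eq_of_formCongr σ ϖ H P γ ϖ' c₀, ncard_selfDual_fixed_rankOne_smul_form_eq σ ϖ hc]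

/-- The rank-one strata, constant `c⁻¹·c₀` for (`H`, `PγP⁻¹`) ↔ constant `c₀` for the model (`c • ᵗσ(P)HP`, `γ`) (`|c| = 1`) — the reading in which the MODEL's class
constant is prescribed (e.g. the junction head's `c₀`, `c₀·ε`). [cite: Rogawski1990, §4.9 p. 55] [cite: Kottwitz1986, §3] -/
theorem ncard_selfDual_fixed_rankOne_eq_of_smul_formCongr_inv (σ : K →+* K) (ϖ : K) {c : K} (hc : Valued.v c = 1) (H : Matrix (Fin N) (Fin N) K) (P γ : GL (Fin N) K)
    (ϖ' c₀ : K) :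
    {M : Submodule 𝒪[K] (Fin N → K) | IsSelfDualLattice σ ϖ H M ∧ mapGL (P * γ * P⁻¹) M = M ∧
        (M.map ((Matrix.toLin' (((P * γ * P⁻¹ : GL (Fin N) K) : Matrix (Fin N) (Fin N) K) - 1)).restrictScalars 𝒪[K]) ≤ scaleLattice ϖ M ∧
          ¬ M.map ((Matrix.toLin' (((P * γ * P⁻¹ : GL (Fin N) K) : Matrix (Fin N) (Fin N) K) - 1)).restrictScalars 𝒪[K]) ≤ scaleLattice (ϖ ^ 2) M ∧
            M.map ((Matrix.toLin' ((((P * γ * P⁻¹ : GL (Fin N) K) : Matrix (Fin N) (Fin N) K) - 1) ^ 2)).restrictScalars 𝒪[K]) ≤ scaleLattice (ϖ ^ 3) M ∧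
              ∃ y ∈ M, ∃ a : K, Valued.v a = 1 ∧
                Valued.v (ϖ' * pairing σ H y ((((P * γ * P⁻¹ : GL (Fin N) K) : Matrix (Fin N) (Fin N) K) - 1) *ᵥ y) - c⁻¹ * c₀ * a ^ 2) < 1)}.ncard =
      {M : Submodule 𝒪[K] (Fin N → K) | IsSelfDualLattice σ ϖ (c • formCongr σ P H) M ∧ mapGL γ M = M ∧
        (M.map ((Matrix.toLin' ((γ : Matrix (Fin N) (Fin N) K) - 1)).restrictScalars 𝒪[K]) ≤ scaleLattice ϖ M ∧
          ¬ M.map ((Matrix.toLin' ((γ : Matrix (Fin N) (Fin N) K) - 1)).restrictScalars 𝒪[K]) ≤ scaleLattice (ϖ ^ 2) M ∧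
            M.map ((Matrix.toLin' (((γ : Matrix (Fin N) (Fin N) K) - 1) ^ 2)).restrictScalars 𝒪[K]) ≤ scaleLattice (ϖ ^ 3) M ∧
              ∃ y ∈ M, ∃ a : K, Valued.v a = 1 ∧
                Valued.v (ϖ' * pairing σ (c • formCongr σ P H) y (((γ : Matrix (Fin N) (Fin N) K) - 1) *ᵥ y) - c₀ * a ^ 2) < 1)}.ncard := by
  rw [ncard_selfDual_fixed_rankOne_eq_of_formCongr σ ϖ H P γ ϖ' (c⁻¹ * c₀), ncard_selfDual_fixed_rankOne_smul_form_eq_inv σ ϖ hc]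

end Literature.NumberTheory.Automorphic.UnitaryLatticeTree

end
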